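import Literature.Analysis.FluidPDE.AxisymmetricNoSwirlApriori
import Literature.Analysis.FluidPDE.AxisymNoSwirlEnstrophyIneq
import Literature.Analysis.FluidPDE.AxisymNoSwirlTaoBounds
import Literature.Analysis.FluidPDE.SerrinEnstrophyGronwall
import Literature.Analysis.FluidPDE.TaoEnergyLocalisationProofs
import HarnessLib

/-!
# Proof of `axisymmetricNoSwirl_enstrophy_apriori` (Lemarié-Rieusset 2016, Thm. 10.4)

Analysis/FluidPDE proof file discharging the named fact
`Literature.Analysis.FluidPDE.axisymmetricNoSwirl_enstrophy_apriori`
(`AxisymmetricNoSwirlApriori.lean`): Ladyzhenskaya's a-priori enstrophy bound for Tao-class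
solutions of the Navier–Stokes equations which are axisymmetric without swirl
(Lemarié-Rieusset 2016, Thm. 10.4, proof pp. 285–289; Ladyzhenskaya 1968, Ukhovskii–Yudovich
1968, Leonardi–Málek–Nečas–Pokorný 1999). The theorem is
`axisymmetricNoSwirl_enstrophy_apriori_holds`.

## The proof (`f = 0`)

With `ω = curl u = f · J`, `f = ω_θ/r` (the smooth Hadamard quotient of
`AxisymNoSwirlVorticity`), `Y(t) = ‖ω(t)‖₂²`, `D(t) = ‖∇ω(t)‖²_{L²}` (Frobenius):

1. **Uniform slab bounds in Tao's class** (`AxisymNoSwirlTaoBounds`): `|u| ≤ V`, `|f| ≤ F`,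
   `‖∇f‖ ≤ G`, `ω, ∇ω, f ∈ L²` uniformly on `[0, T']` — these only enter error terms.
2. **Ladyzhenskaya's estimate** (10.27) (`ladyzhenskaya_weighted_estimate`):
   `‖f(t)‖₂² ≤ ‖f(0)‖₂² ≤ 3κ² ‖D²u₀‖₂² ≤ 3κ²H₀ =: F₀²` (`κ = ‖curlCLM‖`; pointwise
   `f² ≤ |∇ω|²`).
3. **The enstrophy inequality** (p. 289) (`enstrophy_integral_le`):
   `Y(t) + 2ν∫₀ᵗ D ≤ Y(0) + 2∫₀ᵗ Φ` for any `L¹` majorant `Φ` of `∫ |f| |ω| |u|`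
   (`|⟨ω, (ω·∇)u⟩| = |u_r| ω_θ²/r ≤ |u| |f| |ω|`).
4. **The majorant** (`stretch_integral_le_majorant`): by Cauchy–Schwarz and step 2,
   `∫ |f| |ω| |u| ≤ ‖u‖_∞ F₀ √Y`; by the Sobolev imbedding `H² ⊂ C_B`
   (`FunctionSpaces.exists_enorm_le_sobolev_two_two_dim_three`, constant `K_S`), the energy
   inequality `‖u(t)‖₂² ≤ E₀` and the `div`–`curl` bounds `‖Du‖₂² ≤ K_d Y`, `‖D²u‖₂² ≤ K_d D`
   (`tao2011_sobolev_of_vorticity_holds`), `‖u‖_∞ ≤ K_S(√E₀ + √(K_d Y) + √(K_d D))`; Young's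
   inequality then gives `Φ = (ν/2) D + A + M Y`, `A = K_S F₀ √E₀/2`,
   `M = A + K_S F₀ √K_d + (K_S F₀ √K_d)²/(2ν)` (the book uses the sharper homogeneous
   `‖u_r‖_∞ ≲ ‖ω‖₂^{1/2}‖ω‖_{Ḣ¹}^{1/2}`, giving the explicit `exp(Cν^{−1/3}‖ω₀‖_{Ḣ¹}^{4/3}t)`; any
   such closing suffices for the existential constant of the fact).
5. **Grönwall** (`gronwall_const_of_integral_le`, from the tree's `lintegral_gronwall_le`):
   `Y(t) ≤ (Y(0) + 2AT) e^{2MT}`, `Y(0) ≤ κ² G₀`; and back to `‖Du(t)‖₂² ≤ K_d Y(t)`.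

The constant is `K = K_d (κ²G₀ + 2AT) e^{2MT}`, a function of `(ν, T, E₀, G₀, H₀)` and the
universal constants `K_S, K_d, κ` only.

## References

* P. G. Lemarié-Rieusset, *The Navier–Stokes Problem in the 21st Century*, CRC Press (2016),
  §10.3, Thm. 10.4 (p. 285) and its proof, pp. 285–289. [LemarieRieusset2016]
* O. A. Ladyzhenskaya, Zap. Naučn. Sem. LOMI 7 (1968) 155–177; M. R. Ukhovskii,
  V. I. Yudovich, J. Appl. Math. Mech. 32 (1968) 52–69; S. Leonardi, J. Málek, J. Nečas,
  M. Pokorný, Z. Anal. Anwendungen 18 (1999) 639–649 (the book's [295], [486], [326]).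
* J. C. Robinson, J. L. Rodrigo, W. Sadowski, *The Three-Dimensional Navier–Stokes Equations*,
  CUP 2016, Lemma A.25 (Grönwall). [RobinsonRodrigoSadowski2016]
-/

noncomputable section

open Set Function Filter MeasureTheory Metric Topology intervalIntegral
open scoped RealInnerProductSpace ENNReal NNReal Topology Interval

namespace Literature.Analysis.FluidPDE

/-! ### Real-variable tools -/

section Tools

/-- **Young's inequality in the form used for the stretching term**:
`c d y ≤ (ν/2) d² + (c²/(2ν)) y²` for `ν > 0`. [folklore] -/
theorem mul_mul_le_young {ν c d y : ℝ} (hν : 0 < ν) :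
    c * d * y ≤ ν / 2 * d ^ 2 + c ^ 2 / (2 * ν) * y ^ 2 := by
  have key : 2 * ν * (c * d * y) ≤ ν ^ 2 * d ^ 2 + c ^ 2 * y ^ 2 := by
    nlinarith [sq_nonneg (ν * d - c * y)]
  have e : ν / 2 * d ^ 2 + c ^ 2 / (2 * ν) * y ^ 2 = (ν ^ 2 * d ^ 2 + c ^ 2 * y ^ 2) / (2 * ν) := by
    field_simp
  rw [e, le_div_iff₀ (by positivity)]
  linarith

end Tools

/-! ### The stretching majorant at a fixed time -/

section Majorant

variable {v : EuclideanSpace ℝ (Fin 3) → EuclideanSpace ℝ (Fin 3)}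

/-- **The data-dependent majorant of the stretching integral** (Lemarié-Rieusset 2016, p. 289:
`|∫ u_r ω_θ²/r| ≤ ‖u‖_∞ ‖ω‖₂ ‖ω/r‖₂` with `‖u‖_∞ ≲ ‖u‖^{·}_{Ḣ¹}‖u‖^{·}_{Ḣ²}`, then Young; here with
the inhomogeneous Sobolev bound `‖u‖_∞ ≤ K_S(‖u‖₂ + ‖Du‖₂ + ‖D²u‖₂)` and the `div`–`curl`
bounds `‖Du‖₂² ≤ K_d‖ω‖₂²`, `‖D²u‖₂² ≤ K_d‖∇ω‖₂²`). If `|v| ≤ K_S(√E₀ + √(K_d Y) + √(K_d D))`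
pointwise, `Y = ∫|ω|²`, `D = ∫|Dω|²_F`, and `∫ f² ≤ F₀²` (`f = ω_θ/r`), then
`∫ |f| |ω| |v| ≤ (ν/2) D + A + M Y` with `A = K_S F₀ √E₀/2`,
`M = K_S F₀ √E₀/2 + K_S F₀ √K_d + (K_S F₀ √K_d)²/(2ν)`. [cite: LemarieRieusset2016, §10.3 p. 289] -/
theorem stretch_integral_le_majorant {ν : ℝ} (hν : 0 < ν) {KS Kd E₀ F₀sq : ℝ} (hKS : 0 ≤ KS)
    (hKd : 0 ≤ Kd) (hv3 : ContDiff ℝ 3 v)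
    (hsup : ∀ x, ‖v x‖ ≤ KS * (Real.sqrt E₀ + Real.sqrt (Kd * ∫ y, ‖curl v y‖ ^ 2) +
      Real.sqrt (Kd * ∫ y, frobeniusNormSq (fderiv ℝ (curl v) y))))
    (hY : Integrable fun x => ‖curl v x‖ ^ 2)
    (hf : Integrable fun x => hadamardQuotFst (fun y => curl v y 1) x ^ 2)
    (hfF : ∫ x, hadamardQuotFst (fun y => curl v y 1) x ^ 2 ≤ F₀sq)
    (hSi : Integrable fun x =>
      |hadamardQuotFst (fun y => curl v y 1) x| * ‖curl v x‖ * ‖v x‖) :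
    ∫ x, |hadamardQuotFst (fun y => curl v y 1) x| * ‖curl v x‖ * ‖v x‖ ≤
      ν / 2 * (∫ x, frobeniusNormSq (fderiv ℝ (curl v) x)) +
        KS * Real.sqrt F₀sq * Real.sqrt E₀ / 2 +
        (KS * Real.sqrt F₀sq * Real.sqrt E₀ / 2 + KS * Real.sqrt F₀sq * Real.sqrt Kd +
          (KS * Real.sqrt F₀sq * Real.sqrt Kd) ^ 2 / (2 * ν)) * ∫ x, ‖curl v x‖ ^ 2 := by
  set f : EuclideanSpace ℝ (Fin 3) → ℝ := hadamardQuotFst (fun y => curl v y 1) with hfdef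
  set Y : ℝ := ∫ x, ‖curl v x‖ ^ 2 with hYdef
  set D : ℝ := ∫ x, frobeniusNormSq (fderiv ℝ (curl v) x) with hDdef
  set F₀ : ℝ := Real.sqrt F₀sq with hF₀
  set B : ℝ := KS * (Real.sqrt E₀ + Real.sqrt (Kd * Y) + Real.sqrt (Kd * D)) with hBdef
  have hv2 : ContDiff ℝ 2 v := hv3.of_le (by norm_cast)
  have hf1 : ContDiff ℝ 1 f := contDiff_hadamardQuotFst_curl (n := 1) (by exact_mod_cast hv3)
  have hωc : Continuous (curl v) := (contDiff_curl (n := 1) (by exact_mod_cast hv2)).continuous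
  have hY0 : 0 ≤ Y := integral_nonneg fun x => sq_nonneg _
  have hD0 : 0 ≤ D := integral_nonneg fun x => frobeniusNormSq_nonneg _
  have hB0 : 0 ≤ B := by positivity
  have hF₀0 : 0 ≤ F₀ := Real.sqrt_nonneg _
  -- `∫ |f| |ω| |v| ≤ B ∫ |f| |ω|`
  have hfω : Integrable fun x => |f x| * ‖curl v x‖ := by
    have hsum : Integrable fun x => 1 / 2 * (f x ^ 2 + ‖curl v x‖ ^ 2) :=
      (hf.add hY).const_mul (1 / 2)
    refine hsum.mono' (hf1.continuous.abs.mul hωc.norm).aestronglyMeasurable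
      (ae_of_all _ fun x => ?_)
    rw [Real.norm_eq_abs, abs_of_nonneg (by positivity)]
    nlinarith [sq_nonneg (|f x| - ‖curl v x‖), sq_abs (f x)]
  have h1 : ∫ x, |f x| * ‖curl v x‖ * ‖v x‖ ≤ B * ∫ x, |f x| * ‖curl v x‖ := by
    rw [← MeasureTheory.integral_const_mul]
    refine integral_mono hSi (hfω.const_mul B) fun x => ?_
    calc |f x| * ‖curl v x‖ * ‖v x‖ ≤ |f x| * ‖curl v x‖ * B :=
          mul_le_mul_of_nonneg_left (hsup x) (by positivity)
      _ = B * (|f x| * ‖curl v x‖) := by ring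
  -- Cauchy–Schwarz: `∫ |f| |ω| ≤ F₀ √Y`
  have h2 : ∫ x, |f x| * ‖curl v x‖ ≤ F₀ * Real.sqrt Y := by
    have hf' : Integrable fun x => |f x| ^ 2 := by simpa only [sq_abs] using hf
    have hcs := integral_mul_le_sqrt_mul_sqrt (fun x => abs_nonneg _) (fun x => norm_nonneg _)
      hf1.continuous.abs.aestronglyMeasurable hωc.norm.aestronglyMeasurable hf' hY
    simp only [sq_abs] at hcs
    refine hcs.trans (mul_le_mul_of_nonneg_right ?_ (Real.sqrt_nonneg _))
    exact Real.sqrt_le_sqrt hfF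
  -- algebra with `y = √Y`, `d = √D`
  set y : ℝ := Real.sqrt Y with hy
  set d : ℝ := Real.sqrt D with hd
  have hy0 : 0 ≤ y := Real.sqrt_nonneg _
  have hd0 : 0 ≤ d := Real.sqrt_nonneg _
  have hyY : y ^ 2 = Y := Real.sq_sqrt hY0
  have hdD : d ^ 2 = D := Real.sq_sqrt hD0
  have hBy : B = KS * (Real.sqrt E₀ + Real.sqrt Kd * y + Real.sqrt Kd * d) := by
    rw [hBdef, Real.sqrt_mul hKd, Real.sqrt_mul hKd]
  have hS : ∫ x, |f x| * ‖curl v x‖ * ‖v x‖ ≤ B * (F₀ * y) :=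
    h1.trans (mul_le_mul_of_nonneg_left h2 hB0)
  -- the three pieces of `B F₀ y`
  have p1 : KS * Real.sqrt E₀ * (F₀ * y) ≤ KS * F₀ * Real.sqrt E₀ / 2 * (1 + y ^ 2) := by
    have : y ≤ (1 + y ^ 2) / 2 := by nlinarith [sq_nonneg (y - 1)]
    have h0 : 0 ≤ KS * Real.sqrt E₀ * F₀ := by positivity
    calc KS * Real.sqrt E₀ * (F₀ * y) = (KS * Real.sqrt E₀ * F₀) * y := by ring
      _ ≤ (KS * Real.sqrt E₀ * F₀) * ((1 + y ^ 2) / 2) := mul_le_mul_of_nonneg_left this h0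
      _ = KS * F₀ * Real.sqrt E₀ / 2 * (1 + y ^ 2) := by ring
  have p3 : KS * (Real.sqrt Kd * d) * (F₀ * y) ≤
      ν / 2 * d ^ 2 + (KS * F₀ * Real.sqrt Kd) ^ 2 / (2 * ν) * y ^ 2 := by
    have := mul_mul_le_young (c := KS * F₀ * Real.sqrt Kd) (d := d) (y := y) hν
    calc KS * (Real.sqrt Kd * d) * (F₀ * y) = KS * F₀ * Real.sqrt Kd * d * y := by ring
      _ ≤ _ := this
  have hsplit : B * (F₀ * y) = KS * Real.sqrt E₀ * (F₀ * y) + KS * F₀ * Real.sqrt Kd * y ^ 2 +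
      KS * (Real.sqrt Kd * d) * (F₀ * y) := by
    rw [hBy]; ring
  rw [hsplit] at hS
  rw [← hyY, ← hdD]
  nlinarith [hS, p1, p3]

end Majorant

/-! ### Grönwall bookkeeping -/

section Gronwall

/-- **Grönwall's lemma for a bounded nonnegative function** (integral form, constant kernel):
if `0 ≤ Y ≤ Y⋆` on `[0, S]`, `Y` is integrable on `[0, S]`, and
`Y(τ) ≤ B + 2M ∫₀^τ Y` for every `τ ∈ [0, S]` (`B, M ≥ 0`), then `Y(τ) ≤ B exp(2Mτ)` on
`[0, S]` (the tree's measurability-free `lintegral_gronwall_le`).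
[cite: RobinsonRodrigoSadowski2016, Lemma A.25] -/
theorem gronwall_const_of_integral_le {S B M Ystar : ℝ} (hS : 0 < S) (hB : 0 ≤ B) (hM : 0 ≤ M)
    {Y : ℝ → ℝ} (hY0 : ∀ τ ∈ Icc 0 S, 0 ≤ Y τ) (hYb : ∀ τ ∈ Icc 0 S, Y τ ≤ Ystar)
    (hYi : IntegrableOn Y (Icc 0 S))
    (hineq : ∀ τ ∈ Icc 0 S, Y τ ≤ B + 2 * M * ∫ s in (0 : ℝ)..τ, Y s) :
    ∀ τ ∈ Icc 0 S, Y τ ≤ B * Real.exp (2 * M * τ) := by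
  have _ := hS
  set φ : ℝ → ℝ≥0∞ := fun s => ENNReal.ofReal (Y s) with hφ
  set a : ℝ → ℝ≥0∞ := fun _ => ENNReal.ofReal (2 * M) with ha
  have hYs0 : 0 ≤ Ystar := (hY0 0 ⟨le_rfl, hS.le⟩).trans (hYb 0 ⟨le_rfl, hS.le⟩)
  have hφM : ∀ τ ∈ Icc 0 S, φ τ ≤ ENNReal.ofReal Ystar := fun τ hτ =>
    ENNReal.ofReal_le_ofReal (hYb τ hτ)
  have haint : ∫⁻ s in Ioo 0 S, a s ≠ ⊤ := by
    rw [ha, setLIntegral_const]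
    exact ENNReal.mul_ne_top ENNReal.ofReal_ne_top (by simp)
  -- the hypothesis of `lintegral_gronwall_le`
  have hmain : ∀ τ ∈ Icc 0 S, φ τ ≤ ENNReal.ofReal B + ∫⁻ s in Ioo 0 τ, a s * φ s := by
    intro τ hτ
    have hYiτ : IntegrableOn Y (Ioo 0 τ) := hYi.mono_set (Ioo_subset_Icc_self.trans
      (Icc_subset_Icc le_rfl hτ.2))
    have hnn : 0 ≤ᵐ[volume.restrict (Ioo 0 τ)] Y :=
      (ae_restrict_iff' measurableSet_Ioo).2 (ae_of_all _ fun s hs =>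
        hY0 s ⟨hs.1.le, hs.2.le.trans hτ.2⟩)
    have hconv : ∫⁻ s in Ioo 0 τ, a s * φ s =
        ENNReal.ofReal (2 * M * ∫ s in (0 : ℝ)..τ, Y s) := by
      rw [ha, hφ, lintegral_const_mul' _ _ ENNReal.ofReal_ne_top,
        ← ofReal_integral_eq_lintegral_ofReal hYiτ hnn, ← ENNReal.ofReal_mul (by positivity),
        intervalIntegral.integral_of_le hτ.1, integral_Ioc_eq_integral_Ioo]
    rw [hconv, ← ENNReal.ofReal_add hB (by
      have : 0 ≤ ∫ s in (0 : ℝ)..τ, Y s :=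
        intervalIntegral.integral_nonneg hτ.1 fun s hs => hY0 s ⟨hs.1, hs.2.trans hτ.2⟩
      positivity)]
    exact ENNReal.ofReal_le_ofReal (hineq τ hτ)
  intro τ hτ
  have h := lintegral_gronwall_le (φ := φ) (a := a) ENNReal.ofReal_ne_top ENNReal.ofReal_ne_top
    hφM haint hmain τ hτ
  have hexp : (∫⁻ s in Ioo 0 τ, a s).toReal = 2 * M * τ := by
    rw [ha, setLIntegral_const, Real.volume_Ioo, ENNReal.toReal_mul, ENNReal.toReal_ofReal
      (by positivity), ENNReal.toReal_ofReal (by linarith [hτ.1])]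
    ring
  rw [hexp] at h
  have h' : ENNReal.ofReal (Y τ) ≤ ENNReal.ofReal (B * Real.exp (2 * M * τ)) := by
    refine h.trans (le_of_eq ?_)
    rw [ENNReal.ofReal_mul hB]
  exact (ENNReal.ofReal_le_ofReal_iff (by positivity)).1 h'

end Gronwall

/-! ### The discharge -/

section Main

/-- Conversion: a lower-integral bound `∫⁻ ‖h‖ₑ² ≤ ofReal C` gives `∫ ‖h‖² ≤ C` for continuous
`h` and `C ≥ 0`. [folklore] -/
theorem integral_sq_norm_le_of_lintegral_le {F : Type*} [NormedAddCommGroup F]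
    {h : EuclideanSpace ℝ (Fin 3) → F} (hc : Continuous h) {C : ℝ} (hC : 0 ≤ C)
    (hle : ∫⁻ x, ‖h x‖ₑ ^ 2 ≤ ENNReal.ofReal C) : ∫ x, ‖h x‖ ^ 2 ≤ C := by
  rw [integral_sq_norm_eq_toReal hc]
  exact ENNReal.toReal_le_of_le_ofReal hC hle

/-- `(ofReal a)^{1/2}` has real part `√a`. [folklore] -/
theorem toReal_ofReal_rpow_half {a : ℝ} (ha : 0 ≤ a) :
    ((ENNReal.ofReal a) ^ (1 / 2 : ℝ)).toReal = Real.sqrt a := by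
  rw [← ENNReal.toReal_rpow, ENNReal.toReal_ofReal ha, Real.sqrt_eq_rpow]
set_option maxHeartbeats 400000 in -- buildfix (bf3-g26): 160k/180k FAIL, 200k PASS at accept time; line-neutral budget line
/-- **Discharge of `axisymmetricNoSwirl_enstrophy_apriori`** (Lemarié-Rieusset 2016, Thm. 10.4,
proof pp. 285–289, after Ladyzhenskaya 1968, Ukhovskii–Yudovich 1968,
Leonardi–Málek–Nečas–Pokorný 1999): the a-priori enstrophy bound for Tao-class solutions which
are axisymmetric without swirl. Assembly: uniform slab bounds in Tao's class
(`AxisymNoSwirlTaoBounds`); Ladyzhenskaya's estimate `‖ω_θ/r (t)‖₂² ≤ ‖ω_θ/r (0)‖₂² ≤ 3κ²H₀`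
(`ladyzhenskaya_weighted_estimate`, (10.27)); the whole-space enstrophy inequality with the
stretching majorant `Φ = (ν/2)‖∇ω‖₂² + A + M‖ω‖₂²` obtained from the Sobolev bound for `‖u‖_∞`,
the energy inequality, the `div`–`curl` bounds and Young's inequality
(`enstrophy_integral_le`, `stretch_integral_le_majorant`, p. 289); Grönwall's lemma; and the
`div`–`curl` bound `‖Du(t)‖₂² ≤ K_d ‖ω(t)‖₂²` (`tao2011_sobolev_of_vorticity_holds`). The
constant is `K = K_d (κ²G₀ + 2AT) exp(2MT)` with `A = K_S F₀ √E₀/2`,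
`M = A + K_S F₀ √K_d + (K_S F₀ √K_d)²/(2ν)`, `F₀² = 3κ²H₀`, `κ = ‖curlCLM‖`, `K_S` the
Sobolev imbedding constant. [cite: LemarieRieusset2016, Thm. 10.4 (p. 285), proof pp. 286–289] -/
theorem axisymmetricNoSwirl_enstrophy_apriori_holds : axisymmetricNoSwirl_enstrophy_apriori := by
  intro ν T E₀ G₀ H₀ hν hT hE₀ hG₀ hH₀
  -- universal constants
  obtain ⟨K, hKtop, hS⟩ := FunctionSpaces.exists_enorm_le_sobolev_two_two_dim_three
    (E := EuclideanSpace ℝ (Fin 3)) (F := EuclideanSpace ℝ (Fin 3))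
    (volume : Measure (EuclideanSpace ℝ (Fin 3))) finrank_euclideanSpace_fin
  obtain ⟨Kd, hKd⟩ := tao2011_sobolev_of_vorticity_holds
  set KS : ℝ := K.toReal with hKS
  set κ : ℝ := ‖curlCLM‖ with hκ
  set F₀sq : ℝ := 3 * κ ^ 2 * H₀ with hF₀sq
  set A : ℝ := KS * Real.sqrt F₀sq * Real.sqrt E₀ / 2 with hA
  set M : ℝ := KS * Real.sqrt F₀sq * Real.sqrt E₀ / 2 + KS * Real.sqrt F₀sq * Real.sqrt Kd +
    (KS * Real.sqrt F₀sq * Real.sqrt Kd) ^ 2 / (2 * ν) with hM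
  have hKS0 : 0 ≤ KS := ENNReal.toReal_nonneg
  have hKd0 : 0 ≤ (Kd : ℝ) := Kd.coe_nonneg
  have hκ0 : 0 ≤ κ := by rw [hκ]; exact norm_nonneg curlCLM
  have hF₀sq0 : 0 ≤ F₀sq := by positivity
  have hA0 : 0 ≤ A := by positivity
  have hM0 : 0 ≤ M := by positivity
  refine ⟨(Kd : ℝ) * (κ ^ 2 * G₀ + 2 * A * T) * Real.exp (2 * M * T), by positivity, ?_⟩
  intro T' hT' hT'T u₀ u p htao hax hsw hE hG hH t ht
  have hν0 : 0 ≤ ν := hν.le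
  have hsol := htao.classical
  have h0T : (0 : ℝ) ∈ Icc 0 T' := ⟨le_rfl, hT'.le⟩
  have hsm : ∀ s ∈ Icc 0 T', ContDiff ℝ ((⊤ : ℕ∞) : WithTop ℕ∞) (u s) := fun s hs =>
    hsol.contDiff_velocity hs
  have hsm5 : ∀ s ∈ Icc 0 T', ContDiff ℝ 5 (u s) := fun s hs => (hsm s hs).of_le (by norm_cast)
  have hsm3 : ∀ s ∈ Icc 0 T', ContDiff ℝ 3 (u s) := fun s hs => (hsm s hs).of_le (by norm_cast)
  have hsm2 : ∀ s ∈ Icc 0 T', ContDiff ℝ 2 (u s) := fun s hs => (hsm s hs).of_le (by norm_cast)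
  -- uniform slab bounds
  obtain ⟨V, hV0, hV⟩ := htao.exists_bound_velocity
  obtain ⟨F, G, hFG⟩ := exists_forall_hadamardQuotFst_curl_le hsm5 htao.sobolev
  obtain ⟨C₁, hC₁⟩ := htao.sobolev 1
  obtain ⟨C₂, hC₂⟩ := htao.sobolev 2
  have hfin1 : ∀ s ∈ Icc 0 T', ∫⁻ x, ‖iteratedFDeriv ℝ 1 (u s) x‖ₑ ^ 2 < ⊤ := fun s hs =>
    lt_of_le_of_lt (hC₁ s hs) ENNReal.coe_lt_top
  have hfin2 : ∀ s ∈ Icc 0 T', ∫⁻ x, ‖iteratedFDeriv ℝ 2 (u s) x‖ₑ ^ 2 < ⊤ := fun s hs =>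
    lt_of_le_of_lt (hC₂ s hs) ENNReal.coe_lt_top
  have hYs : ∀ s ∈ Icc 0 T', Integrable (fun x => ‖curl (u s) x‖ ^ 2) ∧
      ∫ x, ‖curl (u s) x‖ ^ 2 ≤ κ ^ 2 * (C₁ : ℝ) := fun s hs => by
    obtain ⟨hi, hle⟩ := integrable_norm_curl_sq (hsm2 s hs) (hfin1 s hs)
    refine ⟨hi, hle.trans (mul_le_mul_of_nonneg_left ?_ (by positivity))⟩
    exact ENNReal.toReal_le_coe_of_le_coe (hC₁ s hs)
  have hDs : ∀ s ∈ Icc 0 T', Integrable (fun x => frobeniusNormSq (fderiv ℝ (curl (u s)) x)) ∧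
      ∫ x, frobeniusNormSq (fderiv ℝ (curl (u s)) x) ≤ 3 * κ ^ 2 * (C₂ : ℝ) := fun s hs => by
    obtain ⟨hi, hle⟩ := integrable_frobeniusNormSq_fderiv_curl (hsm3 s hs) (hfin2 s hs)
    refine ⟨hi, hle.trans (mul_le_mul_of_nonneg_left ?_ (by positivity))⟩
    exact ENNReal.toReal_le_coe_of_le_coe (hC₂ s hs)
  have hfs : ∀ s ∈ Icc 0 T', Integrable (fun x => hadamardQuotFst (fun y => curl (u s) y 1) x ^ 2) ∧
      ∫ x, hadamardQuotFst (fun y => curl (u s) y 1) x ^ 2 ≤ 3 * κ ^ 2 * (C₂ : ℝ) := fun s hs => by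
    obtain ⟨hi, hle⟩ := integrable_hadamardQuotFst_curl_sq (hsm3 s hs) (hax s hs) (hsw s hs)
      (hfin2 s hs)
    refine ⟨hi, hle.trans (mul_le_mul_of_nonneg_left ?_ (by positivity))⟩
    exact ENNReal.toReal_le_coe_of_le_coe (hC₂ s hs)
  have hSis : ∀ s ∈ Icc 0 T', Integrable fun x =>
      |hadamardQuotFst (fun y => curl (u s) y 1) x| * ‖curl (u s) x‖ * ‖u s x‖ := fun s hs =>
    integrable_stretch_density (hsm3 s hs) (hV s hs) (hfs s hs).1 (hYs s hs).1
  -- Ladyzhenskaya's estimate: `∫ f(s)² ≤ ∫ f(0)² ≤ 3κ²H₀`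
  have hf0 : ∫ x, hadamardQuotFst (fun y => curl (u 0) y 1) x ^ 2 ≤ F₀sq := by
    obtain ⟨-, hle⟩ := integrable_hadamardQuotFst_curl_sq (hsm3 0 h0T) (hax 0 h0T) (hsw 0 h0T)
      (hfin2 0 h0T)
    refine hle.trans ?_
    rw [hF₀sq]
    refine mul_le_mul_of_nonneg_left ?_ (by positivity)
    rw [htao.initial]
    exact ENNReal.toReal_le_of_le_ofReal hH₀ hH
  have hLady : ∀ s ∈ Icc 0 T', ∫ x, hadamardQuotFst (fun y => curl (u s) y 1) x ^ 2 ≤ F₀sq :=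
    fun s hs => (ladyzhenskaya_weighted_estimate hT' hν0 hsol hax hsw
      (fun τ hτ x => (hFG τ hτ x).1) (fun τ hτ x => (hFG τ hτ x).2) hV
      (fun τ hτ => (hfs τ hτ).1) (fun τ hτ => (hfs τ hτ).2) s hs).trans hf0
  -- energy: `‖u(s)‖₂ ≤ √E₀`
  have hkin : 2 * VectorCalculus.kineticEnergy u₀ ≤ E₀ := by
    have hu0c : Continuous u₀ := by rw [← htao.initial]; exact (hsm2 0 h0T).continuous
    have h1 : ∫ x, ‖u₀ x‖ ^ 2 ≤ E₀ := integral_sq_norm_le_of_lintegral_le hu0c hE₀ hE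
    rw [VectorCalculus.kineticEnergy]
    linarith
  have henergy : ∀ s ∈ Icc 0 T', eLpNorm (u s) 2 volume ≤ (ENNReal.ofReal E₀) ^ (1 / 2 : ℝ) :=
    fun s hs => by
    refine eLpNorm_two_le_rpow_of_lintegral_sq_le ((htao.lintegral_enorm_sq_le hT' hν0 hs).trans ?_)
    exact ENNReal.ofReal_le_ofReal hkin
  -- Sobolev: `|u(s, x)| ≤ K_S (√E₀ + √(K_d Y(s)) + √(K_d D(s)))`
  have hsup : ∀ s ∈ Icc 0 T', ∀ x, ‖u s x‖ ≤ KS * (Real.sqrt E₀ +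
      Real.sqrt (Kd * ∫ y, ‖curl (u s) y‖ ^ 2) +
      Real.sqrt (Kd * ∫ y, frobeniusNormSq (fderiv ℝ (curl (u s)) y))) := by
    intro s hs x
    obtain ⟨hYi, -⟩ := hYs s hs
    obtain ⟨hDi, -⟩ := hDs s hs
    have hv2 := hsm2 s hs
    have hvs := hsm s hs
    have hL2 : ∫⁻ y, ‖u s y‖ₑ ^ 2 < ⊤ :=
      lt_of_le_of_lt (htao.lintegral_enorm_sq_le hT' hν0 hs) ENNReal.ofReal_lt_top
    obtain ⟨hdc1, hdc2⟩ := hKd hvs (hsol.divFree s hs) hL2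
    -- the three `L²` norms
    set q0 : ℝ≥0∞ := (ENNReal.ofReal E₀) ^ (1 / 2 : ℝ) with hq0
    set q1 : ℝ≥0∞ := (ENNReal.ofReal ((Kd : ℝ) * ∫ y, ‖curl (u s) y‖ ^ 2)) ^ (1 / 2 : ℝ) with hq1
    set q2 : ℝ≥0∞ := (ENNReal.ofReal ((Kd : ℝ) * ∫ y, frobeniusNormSq (fderiv ℝ (curl (u s)) y))) ^
      (1 / 2 : ℝ) with hq2
    have e0 : eLpNorm (iteratedFDeriv ℝ 0 (u s)) 2 volume ≤ q0 := by
      have : eLpNorm (iteratedFDeriv ℝ 0 (u s)) 2 volume = eLpNorm (u s) 2 volume :=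
        eLpNorm_congr_norm_ae (ae_of_all _ fun y => by rw [norm_iteratedFDeriv_zero])
      rw [this]; exact henergy s hs
    have hYlin : ∫⁻ y, ‖curl (u s) y‖ₑ ^ 2 = ENNReal.ofReal (∫ y, ‖curl (u s) y‖ ^ 2) := by
      rw [ofReal_integral_eq_lintegral_ofReal hYi (ae_of_all _ fun y => sq_nonneg _)]
      refine lintegral_congr fun y => ?_
      rw [← ofReal_norm, ENNReal.ofReal_pow (norm_nonneg _)]
    have hDlin : ∫⁻ y, ‖fderiv ℝ (curl (u s)) y‖ₑ ^ 2 ≤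
        ENNReal.ofReal (∫ y, frobeniusNormSq (fderiv ℝ (curl (u s)) y)) := by
      rw [ofReal_integral_eq_lintegral_ofReal hDi (ae_of_all _ fun y => frobeniusNormSq_nonneg _)]
      refine lintegral_mono fun y => ?_
      rw [← ofReal_norm, ← ENNReal.ofReal_pow (norm_nonneg _)]
      exact ENNReal.ofReal_le_ofReal (sq_opNorm_le_frobeniusNormSq _)
    have e1 : eLpNorm (iteratedFDeriv ℝ 1 (u s)) 2 volume ≤ q1 := by
      refine eLpNorm_two_le_rpow_of_lintegral_sq_le (hdc1.trans ?_)
      rw [hYlin, ENNReal.ofReal_mul hKd0, ENNReal.ofReal_coe_nnreal]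
    have e2 : eLpNorm (iteratedFDeriv ℝ 2 (u s)) 2 volume ≤ q2 := by
      refine eLpNorm_two_le_rpow_of_lintegral_sq_le (hdc2.trans ?_)
      rw [ENNReal.ofReal_mul hKd0, ENNReal.ofReal_coe_nnreal]
      exact mul_le_mul_right hDlin _
    have hq0t : q0 ≠ ⊤ := ENNReal.rpow_ne_top_of_nonneg (by norm_num) ENNReal.ofReal_ne_top
    have hq1t : q1 ≠ ⊤ := ENNReal.rpow_ne_top_of_nonneg (by norm_num) ENNReal.ofReal_ne_top
    have hq2t : q2 ≠ ⊤ := ENNReal.rpow_ne_top_of_nonneg (by norm_num) ENNReal.ofReal_ne_top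
    have hen : ‖u s x‖ₑ ≤ K * (q0 + q1 + q2) := by
      refine (hS (u s) hv2 x).trans ?_
      rw [Finset.sum_range_succ, Finset.sum_range_succ, Finset.sum_range_one]
      gcongr
    have hRt : K * (q0 + q1 + q2) ≠ ⊤ :=
      ENNReal.mul_ne_top hKtop.ne (by simp [hq0t, hq1t, hq2t])
    have hY0' : 0 ≤ ∫ y, ‖curl (u s) y‖ ^ 2 := integral_nonneg fun y => sq_nonneg _
    have hD0' : 0 ≤ ∫ y, frobeniusNormSq (fderiv ℝ (curl (u s)) y) :=
      integral_nonneg fun y => frobeniusNormSq_nonneg _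
    calc ‖u s x‖ = (‖u s x‖ₑ).toReal := (toReal_enorm _).symm
      _ ≤ (K * (q0 + q1 + q2)).toReal := ENNReal.toReal_mono hRt hen
      _ = KS * (Real.sqrt E₀ + Real.sqrt (Kd * ∫ y, ‖curl (u s) y‖ ^ 2) +
          Real.sqrt (Kd * ∫ y, frobeniusNormSq (fderiv ℝ (curl (u s)) y))) := by
          rw [ENNReal.toReal_mul, ENNReal.toReal_add (by simp [hq0t, hq1t]) hq2t,
            ENNReal.toReal_add hq0t hq1t, hq0, hq1, hq2, toReal_ofReal_rpow_half hE₀,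
            toReal_ofReal_rpow_half (by positivity), toReal_ofReal_rpow_half (by positivity)]
  -- names for the enstrophy and the dissipation as functions of time
  obtain ⟨Yf, hYf⟩ : ∃ Yf : ℝ → ℝ, ∀ s, Yf s = ∫ x, ‖curl (u s) x‖ ^ 2 := ⟨_, fun s => rfl⟩
  obtain ⟨Df, hDf⟩ : ∃ Df : ℝ → ℝ, ∀ s, Df s = ∫ x, frobeniusNormSq (fderiv ℝ (curl (u s)) x) :=
    ⟨_, fun s => rfl⟩
  have hYfun : Yf = fun s => ∫ x, ‖curl (u s) x‖ ^ 2 := funext hYf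
  have hDfun : Df = fun s => ∫ x, frobeniusNormSq (fderiv ℝ (curl (u s)) x) := funext hDf
  have hYnn : ∀ s, 0 ≤ Yf s := fun s => by rw [hYf]; exact integral_nonneg fun x => sq_nonneg _
  have hDnn' : ∀ s, 0 ≤ Df s := fun s => by
    rw [hDf]; exact integral_nonneg fun x => frobeniusNormSq_nonneg _
  have hYbd : ∀ s ∈ Icc 0 T', Yf s ≤ κ ^ 2 * (C₁ : ℝ) := fun s hs => by rw [hYf]; exact (hYs s hs).2
  have hDbd : ∀ s ∈ Icc 0 T', Df s ≤ 3 * κ ^ 2 * (C₂ : ℝ) := fun s hs => by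
    rw [hDf]; exact (hDs s hs).2
  -- the majorant `Φ`
  set Φ : ℝ → ℝ := fun s => ν / 2 * Df s + A + M * Yf s with hΦ
  have hΦle : ∀ s ∈ Icc 0 T',
      ∫ x, |hadamardQuotFst (fun y => curl (u s) y 1) x| * ‖curl (u s) x‖ * ‖u s x‖ ≤ Φ s :=
    fun s hs => by
    have h := stretch_integral_le_majorant hν hKS0 hKd0 (hsm3 s hs)
      (hsup s hs) (hYs s hs).1 (hfs s hs).1 (hLady s hs) (hSis s hs)
    simp only [hΦ, hA, hM, hYf, hDf]
    exact h
  have hYm : AEStronglyMeasurable Yf (volume.restrict (Icc 0 T')) := by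
    rw [hYfun]
    exact aestronglyMeasurable_enstrophy hT' hsol.smooth_velocity (fun s hs => (hYs s hs).1)
  have hDm : AEStronglyMeasurable Df (volume.restrict (Icc 0 T')) := by
    rw [hDfun]
    exact aestronglyMeasurable_dissipation hT' hsol.smooth_velocity (fun s hs => (hDs s hs).1)
  have hvolT : volume (Icc (0 : ℝ) T') < ⊤ := by simp
  have hYint : IntegrableOn Yf (Icc 0 T') :=
    ⟨hYm, HasFiniteIntegral.restrict_of_bounded (κ ^ 2 * (C₁ : ℝ)) hvolT
      ((ae_restrict_iff' measurableSet_Icc).2 (ae_of_all _ fun s hs => by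
        rw [Real.norm_eq_abs, abs_of_nonneg (hYnn s)]; exact hYbd s hs))⟩
  have hDint : IntegrableOn Df (Icc 0 T') :=
    ⟨hDm, HasFiniteIntegral.restrict_of_bounded (3 * κ ^ 2 * (C₂ : ℝ)) hvolT
      ((ae_restrict_iff' measurableSet_Icc).2 (ae_of_all _ fun s hs => by
        rw [Real.norm_eq_abs, abs_of_nonneg (hDnn' s)]; exact hDbd s hs))⟩
  have hΦint : IntegrableOn Φ (Icc 0 T') :=
    ((hDint.const_mul (ν / 2)).add (integrableOn_const hvolT.ne)).add (hYint.const_mul M)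
  -- the enstrophy inequality, for every `τ ∈ [0, T']`
  have hmain : ∀ τ ∈ Icc 0 T', Yf τ ≤ (Yf 0 + 2 * A * T') + 2 * M * ∫ s in (0 : ℝ)..τ, Yf s := by
    intro τ hτ
    have h := enstrophy_integral_le hT' hν0 hsol hax hsw hV (fun s hs => (hYs s hs).1)
      (fun s hs => (hYs s hs).2) (fun s hs => (hDs s hs).1) (fun s hs => (hDs s hs).2) hSis hΦint
      hΦle hτ
    rw [← hYf, ← hYf] at h
    have hD' : (fun s => ∫ x, frobeniusNormSq (fderiv ℝ (curl (u s)) x)) = Df := hDfun.symm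
    rw [hD'] at h
    have hτT : Icc 0 τ ⊆ Icc 0 T' := Icc_subset_Icc le_rfl hτ.2
    have iD : IntervalIntegrable Df volume 0 τ :=
      (intervalIntegrable_iff_integrableOn_Icc_of_le hτ.1).2 (hDint.mono_set hτT)
    have iY : IntervalIntegrable Yf volume 0 τ :=
      (intervalIntegrable_iff_integrableOn_Icc_of_le hτ.1).2 (hYint.mono_set hτT)
    have i1 : IntervalIntegrable (fun s => ν / 2 * Df s) volume 0 τ := iD.const_mul _
    have i12 : IntervalIntegrable (fun s => ν / 2 * Df s + A) volume 0 τ :=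
      i1.add intervalIntegrable_const
    have i3 : IntervalIntegrable (fun s => M * Yf s) volume 0 τ := iY.const_mul _
    have hsplit : ∫ s in (0 : ℝ)..τ, Φ s =
        ν / 2 * (∫ s in (0 : ℝ)..τ, Df s) + A * τ + M * ∫ s in (0 : ℝ)..τ, Yf s := by
      rw [hΦ, intervalIntegral.integral_add i12 i3, intervalIntegral.integral_add i1
        intervalIntegrable_const, intervalIntegral.integral_const_mul,
        intervalIntegral.integral_const_mul, intervalIntegral.integral_const]
      simp only [sub_zero, smul_eq_mul]
      ring
    have hDnn : 0 ≤ ∫ s in (0 : ℝ)..τ, Df s :=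
      intervalIntegral.integral_nonneg hτ.1 fun s _ => hDnn' s
    have hAτ : A * τ ≤ A * T' := mul_le_mul_of_nonneg_left hτ.2 hA0
    rw [hsplit] at h
    have hνD : 0 ≤ ν * ∫ s in (0 : ℝ)..τ, Df s := mul_nonneg hν0 hDnn
    linarith only [h, hνD, hAτ]
  -- Grönwall
  have hB0 : 0 ≤ Yf 0 + 2 * A * T' := by
    have h1 := hYnn 0
    have h2 : 0 ≤ 2 * A * T' := by positivity
    linarith only [h1, h2]
  have hgr := gronwall_const_of_integral_le hT' hB0 hM0 (fun τ _ => hYnn τ) hYbd hYint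
    hmain t ht
  -- initial enstrophy `≤ κ² G₀`
  have hY0le : Yf 0 ≤ κ ^ 2 * G₀ := by
    obtain ⟨-, hle⟩ := integrable_norm_curl_sq (hsm2 0 h0T) (hfin1 0 h0T)
    rw [hYf]
    refine hle.trans (mul_le_mul_of_nonneg_left ?_ (by positivity))
    rw [htao.initial]
    exact ENNReal.toReal_le_of_le_ofReal hG₀ hG
  have hYt : Yf t ≤ (κ ^ 2 * G₀ + 2 * A * T) * Real.exp (2 * M * T) := by
    refine hgr.trans ?_
    have hAT : 2 * A * T' ≤ 2 * A * T := mul_le_mul_of_nonneg_left hT'T (by positivity)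
    have h1 : Yf 0 + 2 * A * T' ≤ κ ^ 2 * G₀ + 2 * A * T := by linarith only [hY0le, hAT]
    have h2 : Real.exp (2 * M * t) ≤ Real.exp (2 * M * T) :=
      Real.exp_le_exp.2 (mul_le_mul_of_nonneg_left (ht.2.trans hT'T) (by positivity))
    exact mul_le_mul h1 h2 (Real.exp_pos _).le (by positivity)
  -- back to `Du(t)` through the `div`–`curl` bound
  have hL2t : ∫⁻ y, ‖u t y‖ₑ ^ 2 < ⊤ :=
    lt_of_le_of_lt (htao.lintegral_enorm_sq_le hT' hν0 ht) ENNReal.ofReal_lt_top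
  obtain ⟨hdc1, -⟩ := hKd (hsm t ht) (hsol.divFree t ht) hL2t
  have hYlin : ∫⁻ y, ‖curl (u t) y‖ₑ ^ 2 = ENNReal.ofReal (Yf t) := by
    rw [hYf, ofReal_integral_eq_lintegral_ofReal (hYs t ht).1 (ae_of_all _ fun y => sq_nonneg _)]
    refine lintegral_congr fun y => ?_
    rw [← ofReal_norm, ENNReal.ofReal_pow (norm_nonneg _)]
  calc ∫⁻ x, ‖iteratedFDeriv ℝ 1 (u t) x‖ₑ ^ 2 ≤ Kd * ∫⁻ y, ‖curl (u t) y‖ₑ ^ 2 := hdc1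
    _ = ENNReal.ofReal ((Kd : ℝ) * Yf t) := by
        rw [hYlin, ENNReal.ofReal_mul hKd0, ENNReal.ofReal_coe_nnreal]
    _ ≤ ENNReal.ofReal ((Kd : ℝ) * (κ ^ 2 * G₀ + 2 * A * T) * Real.exp (2 * M * T)) := by
        refine ENNReal.ofReal_le_ofReal ?_
        rw [mul_assoc]
        exact mul_le_mul_of_nonneg_left hYt hKd0

end Main

end Literature.Analysis.FluidPDE

end
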